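import Literature.Computation.KummerOrbifold.ClosureCertificate5
import HarnessLib

/-!
# Kummer orbifold model, `m = 5`: closure certificate, image checks II (COMPUTATIONAL, `native_decide`)

Sequel of `ClosureCertificate5` (cell `hodge-kum4`, seat p1; consumer spec 2ea65998af615100): part II of
**(C3b)** — for every Reynolds basis vector `b` of the invariant sub-space `R` and every operator
`T = op5 j`, `j = 12, …, 16` (the four twisted degree-3 generators and `ω₀ = G_15`), the image `T b` is
centralizer-invariant.  Part I (`ClosureCertificate5ImagesI`) does `j = 0, …, 11`.  Together with
`ClosureCertificate5`: `T(R) ⊆ R` for all 17 operators, hence `C₀ ⊆ R`, `dim C₀ ≤ 1566`, and with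
`rankWords5`: `C₀ = R`, `dim C₀ = 1566`.  EVIDENCE for the computed clause of MODEL_X; not used by the
kernel assembly.
-/

set_option autoImplicit false

namespace Literature.Computation.KummerOrbifold

/-- **(C3b, images II)** For every Reynolds basis vector `b` and every operator `T = op5 j`,
`12 ≤ j ≤ 16` (twisted degree-3 generators, `ω₀`), `T b` is centralizer-invariant. [cite: FantechiGoettsche2003, §3 (Thm. 3.10, the ring structure; genus/obstruction rule)] -/
theorem images5_invariant_II :
    reynoldsBasis5Sp.all (imagesInvariantOps [12, 13, 14, 15, 16]) = true := by
  native_decide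

end Literature.Computation.KummerOrbifold
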